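import Summits.AtomisticToContinuum.HydrodynamicLimit.Theorems.InformationPercolationEngineChaosClosesEulerEntropyBalanceE
import HarnessLib

/-!
# Windowed entropy balance — helper F: the functional is Lipschitz along free flight

Helper file for the registered stub `stub_windowedEntropyBalance` of the line `empirical-h-theorem`
(crux `InformationPercolationEngine.ChaosClosesEuler`, stmt-AtomisticToContinuum-15141).

WHAT. Between collisions the windowed coarse-grained entropy functional `𝒮` of helper C moves
Lipschitz-continuously: for every configuration `w` and time `t`,
`|𝒮(S_t w) − 𝒮(w)| ≤ C_L (1 + E(w)/(N+1))² |t|` (`abs_FS_freeFlight_sub_le`), `S_t` the free flight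
on `𝕋³`, with `C_L = (3/(πr³))² r⁻¹ (L_h C_S + C_h (|K| + |log M_g| + 8δ + 10))`. Proof: along free
flight the minimal-image displacement of particle `i` is `≤ |t| |vᵢ|`, the cone weight is
`(3/(πr³)) r⁻¹`-Lipschitz in the particle position, so `|Δρ_r| ≤ (3/(πr³)) r⁻¹ |t| (N+1)⁻¹ Σ|vᵢ|`
and `|Δg_x(v)| ≤ (3/(πr³)) r⁻¹ |t| (N+1)⁻¹ Σ |vᵢ| φ_δ(v − vᵢ)`; the entropy density is
`A(v)`-Lipschitz in `g` (helper A), the linear Gaussian bound `∫ φ_δ(v − vᵢ) A ≤ c + 4|vᵢ| + 8δ`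
(helper B) and `Σ|vᵢ| ≤ (N+1)/2 + E`, `Σ|vᵢ|² = 2E` close the estimate; `h` is bounded and
Lipschitz and `|S| ≤ C_S(1 + E/(N+1))` (helper C).

References: folklore.
-/

noncomputable section

namespace Summit.AtomisticToContinuum.HydrodynamicLimit.Theorems.ChaosClosesEulerEntropyBalance

open scoped BigOperators Topology Classical MeasureTheory ENNReal InnerProductSpace
open Filter Set MeasureTheory ProbabilityTheory
open Literature.MathematicalPhysics.KineticTheory
open Literature.Analysis.FluidPDE
open Summit.AtomisticToContinuum.HydrodynamicLimit.Theorems.LocalSecondLawNegative (cone rhoC cone_nonneg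
  continuous_cone rhoC_nonneg continuous_rhoC)
open Summit.AtomisticToContinuum.HydrodynamicLimit.Theorems.ChaosClosesEulerWindowedInvariance (cone_nonneg_le
  abs_cone_sub_cone_le)
open Summit.AtomisticToContinuum.HydrodynamicLimit.Theorems.ChaosClosesEulerCollisionInvariance (sum_norm_vel_le
  euclidDist_translate_self_le)
open Summit.AtomisticToContinuum.HydrodynamicLimit.Theorems.LocalSecondLawLedger.L (rhoC_eq_sum)

variable {N : ℕ}

/-- The Lipschitz constant `C_L = (3/(πr³))² r⁻¹ (L_h C_S + C_h (|K| + |log M_g| + 8δ + 10))`. [folklore] -/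
def CL (r δ K Ch Lh : ℝ) : ℝ :=
  (3 / (Real.pi * r ^ 3)) ^ 2 * r⁻¹ * (Lh * CS r δ K + Ch * (|K| + |Real.log (Mg r δ)| + 8 * δ + 10))

/-! ## §1 Displacements along free flight -/

/-- Along free flight on the torus the cone weight of particle `i` moves by at most
`(3/(πr³)) r⁻¹ |t| |vᵢ|`. [folklore] -/
theorem abs_cone_freeFlight_sub_le {r : ℝ} (hr : 0 < r) (t : ℝ) (w : Config (N + 1) (Fin 3) T3) (i : Fin (N + 1))
    (x : T3) :
    |cone r (freeFlight (Torus.geometry (Fin 3)) t w i).1 x - cone r (w i).1 x| ≤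
      3 / (Real.pi * r ^ 3) * r⁻¹ * |t| * ‖(w i).2‖ := by
  rw [freeFlight_apply]
  have h1 := abs_cone_sub_cone_le hr ((Torus.geometry (Fin 3)).translate (w i).1 (t • (w i).2)) (w i).1 x
  have h2 := euclidDist_translate_self_le (w i).1 (t • (w i).2)
  rw [norm_smul, Real.norm_eq_abs] at h2
  calc _ ≤ _ := h1
    _ ≤ 3 / (Real.pi * r ^ 3) * (|t| * ‖(w i).2‖ / r) := by gcongr
    _ = _ := by ring

/-- The normalised total speed is controlled by the energy: `(N+1)⁻¹ Σ|vᵢ| ≤ 1/2 + E/(N+1)`. [folklore] -/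
theorem avg_norm_vel_le (w : Config (N + 1) (Fin 3) T3) :
    ((N + 1 : ℕ) : ℝ)⁻¹ * ∑ i, ‖(w i).2‖ ≤ 1 / 2 + configEnergy w / (N + 1 : ℝ) := by
  have hN : (0 : ℝ) < (N : ℝ) + 1 := by positivity
  have h3 := sum_norm_vel_le w
  push_cast at h3 ⊢
  rw [inv_mul_le_iff₀ hN]
  have : ((N : ℝ) + 1) * (1 / 2 + configEnergy w / ((N : ℝ) + 1)) = ((N : ℝ) + 1) / 2 + configEnergy w := by
    field_simp
  linarith

/-- The normalised energy: `(N+1)⁻¹ Σ|vᵢ|² = 2E/(N+1)`. [folklore] -/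
theorem avg_norm_sq_vel_eq (w : Config (N + 1) (Fin 3) T3) :
    ((N + 1 : ℕ) : ℝ)⁻¹ * ∑ i, ‖(w i).2‖ ^ 2 = 2 * (configEnergy w / (N + 1 : ℝ)) := by
  unfold configEnergy
  push_cast
  field_simp

/-- Along free flight `|Δρ_r(x)| ≤ (3/(πr³)) r⁻¹ |t| (1/2 + E/(N+1))`. [folklore] -/
theorem abs_rhoC_freeFlight_sub_le {r : ℝ} (hr : 0 < r) (t : ℝ) (w : Config (N + 1) (Fin 3) T3) (x : T3) :
    |rhoC r (freeFlight (Torus.geometry (Fin 3)) t w) x - rhoC r w x| ≤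
      3 / (Real.pi * r ^ 3) * r⁻¹ * |t| * (1 / 2 + configEnergy w / (N + 1 : ℝ)) := by
  rw [rhoC_eq_sum, rhoC_eq_sum, ← mul_sub, ← Finset.sum_sub_distrib, abs_mul,
    abs_of_nonneg (by positivity : (0 : ℝ) ≤ ((N + 1 : ℕ) : ℝ)⁻¹)]
  have h1 : |∑ i, (cone r (freeFlight (Torus.geometry (Fin 3)) t w i).1 x - cone r (w i).1 x)| ≤
      ∑ i, 3 / (Real.pi * r ^ 3) * r⁻¹ * |t| * ‖(w i).2‖ :=
    (Finset.abs_sum_le_sum_abs _ _).trans (Finset.sum_le_sum fun i _ => abs_cone_freeFlight_sub_le hr t w i x)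
  rw [← Finset.mul_sum] at h1
  have h2 := avg_norm_vel_le w
  have hc : 0 ≤ 3 / (Real.pi * r ^ 3) * r⁻¹ * |t| := by positivity
  calc ((N + 1 : ℕ) : ℝ)⁻¹ * |∑ i, (cone r (freeFlight (Torus.geometry (Fin 3)) t w i).1 x - cone r (w i).1 x)|
      ≤ ((N + 1 : ℕ) : ℝ)⁻¹ * (3 / (Real.pi * r ^ 3) * r⁻¹ * |t| * ∑ i, ‖(w i).2‖) :=
        mul_le_mul_of_nonneg_left h1 (by positivity)
    _ = 3 / (Real.pi * r ^ 3) * r⁻¹ * |t| * (((N + 1 : ℕ) : ℝ)⁻¹ * ∑ i, ‖(w i).2‖) := by ring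
    _ ≤ _ := mul_le_mul_of_nonneg_left h2 hc

/-- Along free flight `|Δg_x(v)| ≤ (3/(πr³)) r⁻¹ |t| (N+1)⁻¹ Σᵢ |vᵢ| φ_δ(v − vᵢ)`. [folklore] -/
theorem abs_gC_freeFlight_sub_le {r δ : ℝ} (hr : 0 < r) (hδ : 0 < δ) (t : ℝ) (w : Config (N + 1) (Fin 3) T3)
    (x : T3) (v : V3) :
    |gC r δ (freeFlight (Torus.geometry (Fin 3)) t w) x v - gC r δ w x v| ≤
      3 / (Real.pi * r ^ 3) * r⁻¹ * |t| * (((N + 1 : ℕ) : ℝ)⁻¹ * ∑ i, ‖(w i).2‖ * phi δ (v - (w i).2)) := by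
  rw [gC_eq_sum, gC_eq_sum, ← mul_sub, ← Finset.sum_sub_distrib, abs_mul,
    abs_of_nonneg (by positivity : (0 : ℝ) ≤ ((N + 1 : ℕ) : ℝ)⁻¹)]
  have hv : ∀ i, (freeFlight (Torus.geometry (Fin 3)) t w i).2 = (w i).2 := fun i => by rw [freeFlight_apply]
  have h1 : |∑ i, (cone r (freeFlight (Torus.geometry (Fin 3)) t w i).1 x *
      phi δ (v - (freeFlight (Torus.geometry (Fin 3)) t w i).2) - cone r (w i).1 x * phi δ (v - (w i).2))| ≤
      ∑ i, 3 / (Real.pi * r ^ 3) * r⁻¹ * |t| * (‖(w i).2‖ * phi δ (v - (w i).2)) := by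
    refine (Finset.abs_sum_le_sum_abs _ _).trans (Finset.sum_le_sum fun i _ => ?_)
    rw [hv i, ← sub_mul, abs_mul, abs_of_nonneg (phi_nonneg hδ _)]
    have h := abs_cone_freeFlight_sub_le hr t w i x
    calc _ ≤ 3 / (Real.pi * r ^ 3) * r⁻¹ * |t| * ‖(w i).2‖ * phi δ (v - (w i).2) :=
          mul_le_mul_of_nonneg_right h (phi_nonneg hδ _)
      _ = _ := by ring
  rw [← Finset.mul_sum] at h1
  calc ((N + 1 : ℕ) : ℝ)⁻¹ * |∑ i, (cone r (freeFlight (Torus.geometry (Fin 3)) t w i).1 x *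
        phi δ (v - (freeFlight (Torus.geometry (Fin 3)) t w i).2) - cone r (w i).1 x * phi δ (v - (w i).2))|
      ≤ ((N + 1 : ℕ) : ℝ)⁻¹ * (3 / (Real.pi * r ^ 3) * r⁻¹ * |t| * ∑ i, ‖(w i).2‖ * phi δ (v - (w i).2)) :=
        mul_le_mul_of_nonneg_left h1 (by positivity)
    _ = _ := by ring

/-! ## §2 The entropy density along free flight -/

/-- Along free flight
`|ΔS(x)| ≤ (3/(πr³)) r⁻¹ |t| (|K| + |log M_g| + 8δ + 10)(1 + E/(N+1))`. [folklore] -/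
theorem abs_SC_freeFlight_sub_le {r δ : ℝ} (hr : 0 < r) (hδ : 0 < δ) (K : ℝ) (t : ℝ)
    (w : Config (N + 1) (Fin 3) T3) (x : T3) :
    |SC r δ K (freeFlight (Torus.geometry (Fin 3)) t w) x - SC r δ K w x| ≤
      3 / (Real.pi * r ^ 3) * r⁻¹ * |t| * ((|K| + |Real.log (Mg r δ)| + 8 * δ + 10) *
        (1 + configEnergy w / (N + 1 : ℝ))) := by
  set wt := freeFlight (Torus.geometry (Fin 3)) t w with hwt
  set c := 3 / (Real.pi * r ^ 3) * r⁻¹ * |t| with hc_def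
  have hc : 0 ≤ c := by positivity
  set M := Mg r δ
  -- the domination of the difference of the integrands
  set D : V3 → ℝ := fun v => ∑ i, c * (((N + 1 : ℕ) : ℝ)⁻¹ * ‖(w i).2‖) * (phi δ (v - (w i).2) * Aw K M v) with hD
  have hIphi : ∀ i, Integrable fun v => phi δ (v - (w i).2) * Aw K M v := fun i =>
    integrable_phi_sub_mul hδ (continuous_Aw K M).measurable (abs_Aw_le_env K M) _
  have hID : Integrable D := integrable_finsetSum _ fun i _ => (hIphi i).const_mul _
  have hpt : ∀ v, |sK (yfl K v) (gC r δ wt x v) - sK (yfl K v) (gC r δ w x v)| ≤ D v := fun v => by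
    have h1 := abs_sK_yfl_sub_le K v (gC_nonneg hr hδ wt x v) (gC_le_Mg hr hδ wt x v) (gC_nonneg hr hδ w x v)
      (gC_le_Mg hr hδ w x v)
    have h2 := abs_gC_freeFlight_sub_le hr hδ t w x v
    have hA : 0 ≤ Aw K M v := zero_le_two.trans (two_le_Aw K M v)
    calc _ ≤ Aw K M v * |gC r δ wt x v - gC r δ w x v| := h1
      _ ≤ Aw K M v * (c * (((N + 1 : ℕ) : ℝ)⁻¹ * ∑ i, ‖(w i).2‖ * phi δ (v - (w i).2))) :=
          mul_le_mul_of_nonneg_left h2 hA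
      _ = D v := by
          simp only [hD, Finset.mul_sum]
          exact Finset.sum_congr rfl fun i _ => by ring
  have h1 : |SC r δ K wt x - SC r δ K w x| ≤ ∫ v, D v := by
    unfold SC
    rw [← integral_sub (integrable_sK_gC hr hδ K wt x) (integrable_sK_gC hr hδ K w x)]
    exact (abs_integral_le_integral_abs).trans
      (integral_mono_of_nonneg (Eventually.of_forall fun v => abs_nonneg _) hID (Eventually.of_forall hpt))
  have h2 : ∫ v, D v ≤ c * ((|K| + |Real.log M| + 2 + 8 * δ) * (((N + 1 : ℕ) : ℝ)⁻¹ * ∑ i, ‖(w i).2‖) +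
      4 * (((N + 1 : ℕ) : ℝ)⁻¹ * ∑ i, ‖(w i).2‖ ^ 2)) := by
    simp only [hD]
    rw [integral_finsetSum _ fun i _ => (hIphi i).const_mul _]
    have hterm : ∀ i, ∫ v, c * (((N + 1 : ℕ) : ℝ)⁻¹ * ‖(w i).2‖) * (phi δ (v - (w i).2) * Aw K M v) ≤
        c * (((N + 1 : ℕ) : ℝ)⁻¹ * ‖(w i).2‖) * (|K| + |Real.log M| + 2 + 4 * ‖(w i).2‖ + 8 * δ) := fun i => by
      rw [integral_const_mul]
      exact mul_le_mul_of_nonneg_left (integral_phi_Aw_le hδ K M (w i).2) (by positivity)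
    refine (Finset.sum_le_sum fun i _ => hterm i).trans (le_of_eq ?_)
    have hexp : ∀ i, c * (((N + 1 : ℕ) : ℝ)⁻¹ * ‖(w i).2‖) * (|K| + |Real.log M| + 2 + 4 * ‖(w i).2‖ + 8 * δ) =
        c * (|K| + |Real.log M| + 2 + 8 * δ) * ((N + 1 : ℕ) : ℝ)⁻¹ * ‖(w i).2‖ +
          c * 4 * ((N + 1 : ℕ) : ℝ)⁻¹ * ‖(w i).2‖ ^ 2 := fun i => by ring
    simp only [hexp, Finset.sum_add_distrib, ← Finset.mul_sum]
    ring
  have h3 := avg_norm_vel_le w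
  have h4 := avg_norm_sq_vel_eq w
  have hE : 0 ≤ configEnergy w / (N + 1 : ℝ) := by unfold configEnergy; positivity
  have hA0 : 0 ≤ |K| + |Real.log M| + 2 + 8 * δ := by positivity
  calc |SC r δ K wt x - SC r δ K w x| ≤ ∫ v, D v := h1
    _ ≤ c * ((|K| + |Real.log M| + 2 + 8 * δ) * (((N + 1 : ℕ) : ℝ)⁻¹ * ∑ i, ‖(w i).2‖) +
        4 * (((N + 1 : ℕ) : ℝ)⁻¹ * ∑ i, ‖(w i).2‖ ^ 2)) := h2
    _ ≤ c * ((|K| + |Real.log M| + 2 + 8 * δ) * (1 / 2 + configEnergy w / (N + 1 : ℝ)) +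
        4 * (2 * (configEnergy w / (N + 1 : ℝ)))) := by
        rw [h4]
        exact mul_le_mul_of_nonneg_left (add_le_add (mul_le_mul_of_nonneg_left h3 hA0) le_rfl) hc
    _ ≤ _ := by
        refine mul_le_mul_of_nonneg_left ?_ hc
        nlinarith [mul_nonneg hA0 hE]

/-! ## §3 The functional along free flight -/

/-- **`𝒮` is Lipschitz along free flight**:
`|𝒮(S_t w) − 𝒮(w)| ≤ C_L (1 + E(w)/(N+1))² |t|`. [folklore] -/
theorem abs_FS_freeFlight_sub_le {r δ : ℝ} (hr : 0 < r) (hδ : 0 < δ) (K : ℝ) {h : ℝ → ℝ} {Ch Lh : ℝ}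
    (hLh : 0 ≤ Lh) (hhb : ∀ a, |h a| ≤ Ch) (hhL : ∀ a b, |h a - h b| ≤ Lh * |a - b|) (x₀ : T3)
    (w : Config (N + 1) (Fin 3) T3) (t : ℝ) :
    |FS r δ K h x₀ (freeFlight (Torus.geometry (Fin 3)) t w) - FS r δ K h x₀ w| ≤
      CL r δ K Ch Lh * (1 + configEnergy w / (N + 1 : ℝ)) ^ 2 * |t| := by
  set wt := freeFlight (Torus.geometry (Fin 3)) t w with hwt
  have hCh : 0 ≤ Ch := (abs_nonneg _).trans (hhb 0)
  have hEt : configEnergy wt = configEnergy w := configEnergy_freeFlight _ t w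
  set e := configEnergy w / (N + 1 : ℝ) with he
  have hE : 0 ≤ e := by simp only [he]; unfold configEnergy; positivity
  set cm := 3 / (Real.pi * r ^ 3) with hcm
  have hcm0 : 0 ≤ cm := by positivity
  set A2 := |K| + |Real.log (Mg r δ)| + 8 * δ + 10 with hA2_def
  have hA2 : 0 ≤ A2 := by positivity
  have hCS := (CS_pos hr hδ K).le
  -- pointwise bound of the difference of the integrands
  have hpt : ∀ x, ‖(cone r x x₀ * h (rhoC r wt x) * SC r δ K wt x) - (cone r x x₀ * h (rhoC r w x) * SC r δ K w x)‖ ≤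
      cm * (Lh * (cm * r⁻¹ * |t| * (1 / 2 + e)) * (CS r δ K * (1 + e)) + Ch * (cm * r⁻¹ * |t| * (A2 * (1 + e)))) := by
    intro x
    have hsplit : cone r x x₀ * h (rhoC r wt x) * SC r δ K wt x - cone r x x₀ * h (rhoC r w x) * SC r δ K w x =
        cone r x x₀ * ((h (rhoC r wt x) - h (rhoC r w x)) * SC r δ K wt x +
          h (rhoC r w x) * (SC r δ K wt x - SC r δ K w x)) := by ring
    rw [Real.norm_eq_abs, hsplit, abs_mul, abs_of_nonneg (cone_nonneg hr _ _)]
    refine mul_le_mul (cone_nonneg_le hr _ _).2 ?_ (abs_nonneg _) hcm0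
    have h1 : |h (rhoC r wt x) - h (rhoC r w x)| ≤ Lh * (cm * r⁻¹ * |t| * (1 / 2 + e)) :=
      (hhL _ _).trans (mul_le_mul_of_nonneg_left (abs_rhoC_freeFlight_sub_le hr t w x) hLh)
    have h2 : |SC r δ K wt x| ≤ CS r δ K * (1 + e) := by
      have := abs_SC_le hr hδ K wt x; rwa [hEt] at this
    have h3 : |SC r δ K wt x - SC r δ K w x| ≤ cm * r⁻¹ * |t| * (A2 * (1 + e)) :=
      abs_SC_freeFlight_sub_le hr hδ K t w x
    calc _ ≤ |(h (rhoC r wt x) - h (rhoC r w x)) * SC r δ K wt x| + |h (rhoC r w x) * (SC r δ K wt x - SC r δ K w x)| :=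
          abs_add_le _ _
      _ ≤ _ := by
          rw [abs_mul, abs_mul]
          exact add_le_add (mul_le_mul h1 h2 (abs_nonneg _) (by positivity))
            (mul_le_mul (hhb _) h3 (abs_nonneg _) hCh)
  have hint := norm_integral_le_of_norm_le_const (μ := (volume : Measure T3)) (Eventually.of_forall hpt)
  rw [probReal_univ, mul_one] at hint
  have hcont : Continuous h := continuous_of_lip hhL
  have hdiff : FS r δ K h x₀ wt - FS r δ K h x₀ w =
      ∫ x, ((cone r x x₀ * h (rhoC r wt x) * SC r δ K wt x) - (cone r x x₀ * h (rhoC r w x) * SC r δ K w x)) := by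
    unfold FS
    rw [integral_sub (integrable_FS_integrand hr hδ K hhb hcont x₀ wt) (integrable_FS_integrand hr hδ K hhb hcont x₀ w)]
  have hCL : CL r δ K Ch Lh = cm ^ 2 * r⁻¹ * (Lh * CS r δ K + Ch * A2) := rfl
  rw [hdiff, ← Real.norm_eq_abs, hCL]
  refine hint.trans ?_
  have h1e : (1 : ℝ) ≤ 1 + e := by linarith
  have hx : (1 / 2 + e) * (1 + e) ≤ (1 + e) ^ 2 := by nlinarith
  have hy : (1 + e) ≤ (1 + e) ^ 2 := by nlinarith
  have key : cm * (Lh * (cm * r⁻¹ * |t| * (1 / 2 + e)) * (CS r δ K * (1 + e)) + Ch * (cm * r⁻¹ * |t| * (A2 * (1 + e)))) =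
      cm ^ 2 * r⁻¹ * |t| * (Lh * CS r δ K * ((1 / 2 + e) * (1 + e)) + Ch * A2 * (1 + e)) := by ring
  rw [key]
  have hr' : 0 ≤ r⁻¹ := inv_nonneg.2 hr.le
  calc cm ^ 2 * r⁻¹ * |t| * (Lh * CS r δ K * ((1 / 2 + e) * (1 + e)) + Ch * A2 * (1 + e))
      ≤ cm ^ 2 * r⁻¹ * |t| * (Lh * CS r δ K * (1 + e) ^ 2 + Ch * A2 * (1 + e) ^ 2) :=
        mul_le_mul_of_nonneg_left (add_le_add (mul_le_mul_of_nonneg_left hx (mul_nonneg hLh hCS))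
          (mul_le_mul_of_nonneg_left hy (mul_nonneg hCh hA2))) (by positivity)
    _ = cm ^ 2 * r⁻¹ * (Lh * CS r δ K + Ch * A2) * (1 + e) ^ 2 * |t| := by ring

/-- REGISTERED SUB-GOAL `stub_windowedEntropyBalanceF` of the line `empirical-h-theorem` (crux
stmt-AtomisticToContinuum-15141): the normalised total speed of a configuration of `N + 1` particles
is controlled by its kinetic energy, `(N+1)⁻¹ Σ|vᵢ| ≤ 1/2 + E/(N+1)` (restating `avg_norm_vel_le`).
[folklore] -/
theorem stub_windowedEntropyBalanceF : ∀ (N : ℕ) (w : Config (N + 1) (Fin 3) T3),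
    ((N + 1 : ℕ) : ℝ)⁻¹ * ∑ i, ‖(w i).2‖ ≤ 1 / 2 + configEnergy w / (N + 1 : ℝ) :=
  fun _ w => avg_norm_vel_le w

end Summit.AtomisticToContinuum.HydrodynamicLimit.Theorems.ChaosClosesEulerEntropyBalance

end
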